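import Summits.QuantumFields.YangMills.Theorems.AllWindowsColdBoxPlaqCostCubicTaylor
import HarnessLib

/-!
# LINE-17 «hypercontractive second-order tilt expansion» on crux `AllWindowsColdBox.BoxMidWindowsSU22` (stmt-QuantumFields-24003):
# the CAP and the measurability of the cubic part `V₃ = tiltCubicW` of the tilt (STUB-PLAN-E §2 E(7): `M₃ = sup_E |V₃|`)

The second clause `∫ e^{4|W|} dν ≤ 4` of stub E `stub_tiltMoments` is assembled from `…AllWindowsColdBox.CappedExpMoment.
setIntegral_exp_mul_abs_le_of_moments`, which asks, for each of the three pieces `X₁ = tiltCubicW`, `X₂ = 13440·β·Σ_e‖a_e‖⁴`,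
`X₃ = 2C₂·Σ_e‖a_e‖²` of the tilt on the small-field event, (a) a.e.-strong measurability under `γ = gaussD`, (b) a CAP `|X| ≤ M` on the event,
(c) hypercontractive even moments.  For `X₂, X₃` these are in `…AllWindowsColdBoxTiltDominators`; this file gives (a) and (b) for `X₁`:

* `continuous_extZero_comp`, `continuous_unscaleTE`, `continuous_chartCubic₃`, **`continuous_tiltCubicW`** / `measurable_tiltCubicW`;
* **`abs_tiltCubicW_le_of_ball`**: if every chart coordinate has `‖unscaleTE H D β t e‖ ≤ R` (`β, R ≥ 0`) then
  `|tiltCubicW ρ H β t| ≤ 24·#(plaquettes touching Λ)·β·R³` (`|T_ρ(s,b,c)| ≤ 2‖s‖‖b‖‖c‖` with `‖s‖ = ‖circV a q‖ ≤ 4R`; six terms, halved).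
  On `lineEvent θ β` (`R = 2·etaOf ≍ H²β^{ε−1/2}`, `#touching ≤ 120(2H+1)⁴`) this is the cap `M₃ ≍ H^{10}β^{3ε−1/2}` of STUB-PLAN-E §2 E(7).

No definition; standard axioms.  HONEST LABEL: helper toward the OPEN registered stub E of one critic-PASSed line on the R2ξ″ RECORD-rung
crux 24003; no stub is proved by name, no crux, rung or summit is proved; the Yang–Mills mass gap is NOT proved by this file.
-/

set_option autoImplicit false

noncomputable section

open scoped Matrix Matrix.Norms.Frobenius
open Finset
open Literature.MathematicalPhysics.QuantumLattice
open Literature.MathematicalPhysics.QuantumFieldTheory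
open Summit.QuantumFields.YangMills.Theorems.WeakCouplingRates
open Summit.QuantumFields.YangMills.Theorems.FreeEnergyLogCoefficient

namespace Summit.QuantumFields.YangMills.Theorems.ColdBoxAllGroups

/-! ## Continuity of the building blocks -/

section Continuity

variable {H : ℕ}

/-- The zero extension of continuously varying free-link data varies continuously, edge by edge. -/
theorem continuous_extZero_comp {X V : Type*} [TopologicalSpace X] [TopologicalSpace V] [Zero V] {w : X → ColdFreeIdx H → V}
    (hw : ∀ e', Continuous fun x => w x e') (e : Literature.MathematicalPhysics.QuantumLattice.ZdEdge 4) :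
    Continuous fun x => extZero (w x) e := by
  unfold extZero
  split_ifs
  · exact continuous_const
  · exact hw _
  · exact continuous_const

/-- `unscaleTE` is continuous (indeed linear), free link by free link. -/
theorem continuous_unscaleTE_apply (D : ℕ) (β : ℝ) (e : ColdFreeIdx H) : Continuous fun t : TSpaceD H D => unscaleTE H D β t e := by
  refine (PiLp.continuous_toLp 2 _).comp (continuous_pi fun i => ?_)
  exact ((PiLp.continuous_apply 2 (fun _ : DirFree H => ℝ) ((dirFreeEquiv H).symm e)).comp (continuous_apply i)).div_const _

/-- The chart coordinates `t ↦ extZero (unscaleTE H D β t) e` are continuous. -/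
theorem continuous_extZero_unscaleTE (D : ℕ) (β : ℝ) (e : Literature.MathematicalPhysics.QuantumLattice.ZdEdge 4) :
    Continuous fun t : TSpaceD H D => extZero (unscaleTE H D β t) e :=
  continuous_extZero_comp (fun e' => continuous_unscaleTE_apply D β e') e

/-- The linear circulation of the chart coordinates is continuous in `t`. -/
theorem continuous_circV_extZero_unscaleTE (D : ℕ) (β : ℝ) (q : Plaq 4) :
    Continuous fun t : TSpaceD H D => circV (extZero (unscaleTE H D β t)) q := by
  unfold circV
  exact (((continuous_extZero_unscaleTE D β _).add (continuous_extZero_unscaleTE D β _)).sub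
    (continuous_extZero_unscaleTE D β _)).sub (continuous_extZero_unscaleTE D β _)

variable {N : ℕ} {G : Type*} [Group G] (ρ : G →* Matrix (Fin N) (Fin N) ℂ)

/-- **The cubic form of the chart is jointly continuous** (a polynomial in the three arguments). -/
theorem continuous_chartCubic₃ {X : Type*} [TopologicalSpace X] {a b c : X → EuclideanSpace ℝ (Fin (dimE ρ))}
    (ha : Continuous a) (hb : Continuous b) (hc : Continuous c) : Continuous fun x => chartCubic ρ (a x) (b x) (c x) := by
  simp only [chartCubic_eq]
  have hL : Continuous (lieIso ρ) := (lieIso ρ).continuous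
  refine Complex.continuous_re.comp ?_
  refine Continuous.matrix_trace ?_
  exact (hL.comp ha).mul (((hL.comp hb).mul (hL.comp hc)).sub ((hL.comp hc).mul (hL.comp hb)))

/-- **The cubic part of the tilt is continuous** in the colour variables. -/
theorem continuous_tiltCubicW (β : ℝ) : Continuous (tiltCubicW ρ H β) := by
  unfold tiltCubicW
  refine continuous_finsetSum _ fun q _ => continuous_const.mul (Continuous.div_const ?_ _)
  have hs := continuous_circV_extZero_unscaleTE (H := H) (dimE ρ) β (q.1, q.2.1.1, q.2.1.2)
  have h1 := continuous_extZero_unscaleTE (H := H) (dimE ρ) β (q.1, q.2.1.1)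
  have h2 := continuous_extZero_unscaleTE (H := H) (dimE ρ) β (q.1 + Pi.single q.2.1.1 1, q.2.1.2)
  have h3 := continuous_extZero_unscaleTE (H := H) (dimE ρ) β (q.1 + Pi.single q.2.1.2 1, q.2.1.1)
  have h4 := continuous_extZero_unscaleTE (H := H) (dimE ρ) β (q.1, q.2.1.2)
  exact (((((continuous_chartCubic₃ ρ hs h1 h2).sub (continuous_chartCubic₃ ρ hs h1 h3)).sub
    (continuous_chartCubic₃ ρ hs h1 h4)).sub (continuous_chartCubic₃ ρ hs h2 h3)).sub
    (continuous_chartCubic₃ ρ hs h2 h4)).add (continuous_chartCubic₃ ρ hs h3 h4)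

/-- The cubic part of the tilt is measurable. -/
theorem measurable_tiltCubicW (β : ℝ) : Measurable (tiltCubicW ρ H β) := (continuous_tiltCubicW ρ β).measurable

end Continuity

/-! ## The cap of `V₃` on the ball `{∀ e, ‖a_e‖ ≤ R}` -/

section Cap

variable {N : ℕ} {G : Type*} [Group G] (ρ : G →* Matrix (Fin N) (Fin N) ℂ) {H : ℕ}

/-- The linear circulation of link data of norm `≤ R` has norm `≤ 4R`. -/
theorem norm_circV_extZero_le {D : ℕ} {w : ColdFreeIdx H → EuclideanSpace ℝ (Fin D)} {R : ℝ} (hR : 0 ≤ R)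
    (hw : ∀ e, ‖w e‖ ≤ R) (q : Plaq 4) : ‖circV (extZero w) q‖ ≤ 4 * R := by
  have hn := norm_extZero_le hR hw
  unfold circV
  have h1 := hn (q.1, q.2.1)
  have h2 := hn (q.1 + Pi.single q.2.1 1, q.2.2)
  have h3 := hn (q.1 + Pi.single q.2.2 1, q.2.1)
  have h4 := hn (q.1, q.2.2)
  calc _ ≤ ‖extZero w (q.1, q.2.1) + extZero w (q.1 + Pi.single q.2.1 1, q.2.2) - extZero w (q.1 + Pi.single q.2.2 1, q.2.1)‖ +
        ‖extZero w (q.1, q.2.2)‖ := norm_sub_le _ _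
    _ ≤ (‖extZero w (q.1, q.2.1) + extZero w (q.1 + Pi.single q.2.1 1, q.2.2)‖ + ‖extZero w (q.1 + Pi.single q.2.2 1, q.2.1)‖) +
        ‖extZero w (q.1, q.2.2)‖ := by gcongr; exact norm_sub_le _ _
    _ ≤ ((‖extZero w (q.1, q.2.1)‖ + ‖extZero w (q.1 + Pi.single q.2.1 1, q.2.2)‖) + ‖extZero w (q.1 + Pi.single q.2.2 1, q.2.1)‖) +
        ‖extZero w (q.1, q.2.2)‖ := by gcongr; exact norm_add_le _ _
    _ ≤ 4 * R := by linarith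

/-- One cubic term on the ball: `|T_ρ(s, b, c)| ≤ 8R³` when `‖s‖ ≤ 4R`, `‖b‖, ‖c‖ ≤ R`. -/
theorem abs_chartCubic_le_of_ball {s b c : EuclideanSpace ℝ (Fin (dimE ρ))} {R : ℝ} (hR : 0 ≤ R) (hs : ‖s‖ ≤ 4 * R)
    (hb : ‖b‖ ≤ R) (hc : ‖c‖ ≤ R) : |chartCubic ρ s b c| ≤ 8 * R ^ 3 := by
  refine (abs_chartCubic_le ρ s b c).trans ?_
  have h1 : 2 * ‖s‖ * ‖b‖ * ‖c‖ ≤ 2 * (4 * R) * R * R := by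
    gcongr
  linarith

/-- **The cap of the cubic part of the tilt.**  If every chart coordinate satisfies `‖unscaleTE H D β t e‖ ≤ R` (`β, R ≥ 0`, `D = dimE ρ`) then
`|tiltCubicW ρ H β t| ≤ 24·#(plaquettesTouching Λ)·β·R³`, `Λ = boxEdges 4 (2H+1)`. -/
theorem abs_tiltCubicW_le_of_ball {β R : ℝ} (hβ : 0 ≤ β) (hR : 0 ≤ R) (t : TSpaceD H (dimE ρ))
    (ht : ∀ e, ‖unscaleTE H (dimE ρ) β t e‖ ≤ R) :
    |tiltCubicW ρ H β t| ≤ 24 * (#(plaquettesTouching (AxialGauge.boxEdges 4 (2 * H + 1))) : ℝ) * β * R ^ 3 := by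
  unfold tiltCubicW
  refine (abs_sum_le_sum_abs _ _).trans ?_
  have hn := norm_extZero_le hR ht
  have hterm : ∀ q ∈ plaquettesTouching (AxialGauge.boxEdges 4 (2 * H + 1)),
      |β * ((chartCubic ρ (circV (extZero (unscaleTE H (dimE ρ) β t)) (q.1, q.2.1.1, q.2.1.2))
            (extZero (unscaleTE H (dimE ρ) β t) (q.1, q.2.1.1))
            (extZero (unscaleTE H (dimE ρ) β t) (q.1 + Pi.single q.2.1.1 1, q.2.1.2)) -
          chartCubic ρ (circV (extZero (unscaleTE H (dimE ρ) β t)) (q.1, q.2.1.1, q.2.1.2))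
            (extZero (unscaleTE H (dimE ρ) β t) (q.1, q.2.1.1))
            (extZero (unscaleTE H (dimE ρ) β t) (q.1 + Pi.single q.2.1.2 1, q.2.1.1)) -
          chartCubic ρ (circV (extZero (unscaleTE H (dimE ρ) β t)) (q.1, q.2.1.1, q.2.1.2))
            (extZero (unscaleTE H (dimE ρ) β t) (q.1, q.2.1.1)) (extZero (unscaleTE H (dimE ρ) β t) (q.1, q.2.1.2)) -
          chartCubic ρ (circV (extZero (unscaleTE H (dimE ρ) β t)) (q.1, q.2.1.1, q.2.1.2))
            (extZero (unscaleTE H (dimE ρ) β t) (q.1 + Pi.single q.2.1.1 1, q.2.1.2))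
            (extZero (unscaleTE H (dimE ρ) β t) (q.1 + Pi.single q.2.1.2 1, q.2.1.1)) -
          chartCubic ρ (circV (extZero (unscaleTE H (dimE ρ) β t)) (q.1, q.2.1.1, q.2.1.2))
            (extZero (unscaleTE H (dimE ρ) β t) (q.1 + Pi.single q.2.1.1 1, q.2.1.2))
            (extZero (unscaleTE H (dimE ρ) β t) (q.1, q.2.1.2)) +
          chartCubic ρ (circV (extZero (unscaleTE H (dimE ρ) β t)) (q.1, q.2.1.1, q.2.1.2))
            (extZero (unscaleTE H (dimE ρ) β t) (q.1 + Pi.single q.2.1.2 1, q.2.1.1))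
            (extZero (unscaleTE H (dimE ρ) β t) (q.1, q.2.1.2))) / 2)| ≤ 24 * β * R ^ 3 := by
    intro q _
    set a := extZero (unscaleTE H (dimE ρ) β t) with ha
    have hs : ‖circV a (q.1, q.2.1.1, q.2.1.2)‖ ≤ 4 * R := norm_circV_extZero_le hR ht _
    have c1 := abs_chartCubic_le_of_ball ρ hR hs (hn (q.1, q.2.1.1)) (hn (q.1 + Pi.single q.2.1.1 1, q.2.1.2))
    have c2 := abs_chartCubic_le_of_ball ρ hR hs (hn (q.1, q.2.1.1)) (hn (q.1 + Pi.single q.2.1.2 1, q.2.1.1))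
    have c3 := abs_chartCubic_le_of_ball ρ hR hs (hn (q.1, q.2.1.1)) (hn (q.1, q.2.1.2))
    have c4 := abs_chartCubic_le_of_ball ρ hR hs (hn (q.1 + Pi.single q.2.1.1 1, q.2.1.2)) (hn (q.1 + Pi.single q.2.1.2 1, q.2.1.1))
    have c5 := abs_chartCubic_le_of_ball ρ hR hs (hn (q.1 + Pi.single q.2.1.1 1, q.2.1.2)) (hn (q.1, q.2.1.2))
    have c6 := abs_chartCubic_le_of_ball ρ hR hs (hn (q.1 + Pi.single q.2.1.2 1, q.2.1.1)) (hn (q.1, q.2.1.2))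
    rw [abs_le] at c1 c2 c3 c4 c5 c6 ⊢
    rw [ha] at c1 c2 c3 c4 c5 c6
    constructor <;> nlinarith
  refine (sum_le_sum hterm).trans ?_
  rw [sum_const, nsmul_eq_mul]
  ring_nf
  rfl

end Cap

end Summit.QuantumFields.YangMills.Theorems.ColdBoxAllGroups

end
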